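import Literature.Barriers.MatrixMultiplication.UniversalMethodBarrierSliceRank
import HarnessLib

/-!
# Relabelling lemmas: splitting powers, products and rotations of multiples `F ⊙ ⟨A,B,C⟩`

Topic `Literature/Barriers/MatrixMultiplication`; part of the PROOF of `UniversalMethodBarrier`
(Alman 2021): the bookkeeping behind the symmetrisation step of the proof of Thm. 2.9
("`T^{⊗3n}` has a degeneration to `F³ ⊙ ⟨abc, abc, abc⟩`"). Every statement is a restriction
`TensorRestrictsTo` obtained from an equality of coordinate tensors up to a bijection of index sets
(`tensorRestrictsTo_precomp` / `tensorRestrictsTo_of_reindex`); all PROVED over a commutative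
semiring. `F ⊙ t` is written `⟨F⟩ ⊗ t = kroneckerTensor (unitTensor K F) t` as in
`TensorMultiples.lean`.

## Content

* `tensorRestrictsTo_kronecker_interchange` — `(s ⊗ x) ⊗ (s' ⊗ y) ≥ (s ⊗ s') ⊗ (x ⊗ y)`.
* `tensorRestrictsTo_kroneckerPow_add` — `t^{⊗(m+m')} ≥ t^{⊗m} ⊗ t^{⊗m'}` (`Fin.append`);
  `tensorRestrictsTo_kroneckerPow_mul` — `t^{⊗(Nn)} ≥ (t^{⊗n})^{⊗N}` (`finProdFinEquiv`);
  `tensorRestrictsTo_kroneckerPow_of_eq`.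
* `tensorRestrictsTo_kronecker_matMulTensor` — `⟨k,m,n⟩ ⊗ ⟨k',m',n'⟩ ≥ ⟨kk',mm',nn'⟩` (Bläser 2013,
  p. 24; the tree's `kroneckerTensor_matMulTensor`); `unitTensor_eq_kronecker_comp`,
  `tensorRestrictsTo_unitTensor_mul` — `⟨F⟩ ⊗ ⟨F'⟩ ≥ ⟨FF'⟩`;
  `tensorRestrictsTo_multiple_matMulTensor_of_eq`;
  `tensorRestrictsTo_kronecker_multiple_matMulTensor` —
  `(F ⊙ ⟨A,B,C⟩) ⊗ (F' ⊙ ⟨A',B',C'⟩) ≥ (FF') ⊙ ⟨AA',BB',CC'⟩`.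
* `tensorRestrictsTo_rotate_multiple_matMulTensor` — `rot(F ⊙ ⟨A,B,C⟩) ≥ F ⊙ ⟨B,C,A⟩` (Bläser 2013,
  Lemma 5.5; the tree's `matMulTensor_rotate`).

## References

* J. Alman, Theory of Computing 17 (2021), proof of Thm. 2.9 (p. 13). [Alman2021]
* M. Bläser, *Fast Matrix Multiplication*, ToC Graduate Surveys 5 (2013), Lemma 5.5, p. 24. [Blaser2013]
-/

noncomputable section

open scoped BigOperators

namespace Literature.Barriers.MatrixMultiplication

open Literature.Computability.AlgebraicComplexity

universe u

section Generic

variable {K : Type u} [CommSemiring K]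
variable {ι κ μ ι' κ' μ' : Type*}

/-- **Middle-four interchange**: `(s ⊗ x) ⊗ (s' ⊗ y) ≥ (s ⊗ s') ⊗ (x ⊗ y)` (relabelling).
[folklore] -/
theorem tensorRestrictsTo_kronecker_interchange {ι₁ κ₁ μ₁ ι₂ κ₂ μ₂ ι₃ κ₃ μ₃ : Type*}
    [Fintype ι] [Fintype κ] [Fintype μ] [Fintype ι₁] [Fintype κ₁] [Fintype μ₁] [Fintype ι₂]
    [Fintype κ₂] [Fintype μ₂] [Fintype ι₃] [Fintype κ₃] [Fintype μ₃] [DecidableEq ι]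
    [DecidableEq κ] [DecidableEq μ] [DecidableEq ι₁] [DecidableEq κ₁] [DecidableEq μ₁]
    [DecidableEq ι₂] [DecidableEq κ₂] [DecidableEq μ₂] [DecidableEq ι₃] [DecidableEq κ₃]
    [DecidableEq μ₃] (s : ι → κ → μ → K) (x : ι₁ → κ₁ → μ₁ → K) (s' : ι₂ → κ₂ → μ₂ → K)
    (y : ι₃ → κ₃ → μ₃ → K) :
    TensorRestrictsTo (kroneckerTensor (kroneckerTensor s x) (kroneckerTensor s' y))
      (kroneckerTensor (kroneckerTensor s s') (kroneckerTensor x y)) := by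
  have key : kroneckerTensor (kroneckerTensor s s') (kroneckerTensor x y) = fun a b c =>
      kroneckerTensor (kroneckerTensor s x) (kroneckerTensor s' y)
        (Equiv.prodProdProdComm _ _ _ _ a) (Equiv.prodProdProdComm _ _ _ _ b)
        (Equiv.prodProdProdComm _ _ _ _ c) := by
    funext a b c
    simp only [kroneckerTensor_apply, Equiv.prodProdProdComm_apply]
    ring
  rw [key]
  exact tensorRestrictsTo_precomp _ _ _ _

/-- **Splitting a power**: `t^{⊗(m+m')} ≥ t^{⊗m} ⊗ t^{⊗m'}` (relabelling along `Fin.append`).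
[folklore] -/
theorem tensorRestrictsTo_kroneckerPow_add [Fintype ι] [Fintype κ] [Fintype μ] [DecidableEq ι]
    [DecidableEq κ] [DecidableEq μ] (t : ι → κ → μ → K) (m m' : ℕ) :
    TensorRestrictsTo (kroneckerPow t (m + m')) (kroneckerTensor (kroneckerPow t m) (kroneckerPow t m')) := by
  have key : kroneckerTensor (kroneckerPow t m) (kroneckerPow t m') = fun a b c =>
      kroneckerPow t (m + m') (Fin.append a.1 a.2) (Fin.append b.1 b.2) (Fin.append c.1 c.2) := by
    funext a b c
    simp only [kroneckerTensor_apply, kroneckerPow_apply, Fin.prod_univ_add, Fin.append_left,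
      Fin.append_right]
  rw [key]
  exact tensorRestrictsTo_precomp _ _ _ _

/-- **Power of a power**: `t^{⊗(N n)} ≥ (t^{⊗n})^{⊗N}` (relabelling along `finProdFinEquiv`).
[folklore] -/
theorem tensorRestrictsTo_kroneckerPow_mul [Fintype ι] [Fintype κ] [Fintype μ] [DecidableEq ι]
    [DecidableEq κ] [DecidableEq μ] (t : ι → κ → μ → K) (N n : ℕ) :
    TensorRestrictsTo (kroneckerPow t (N * n)) (kroneckerPow (kroneckerPow t n) N) := by
  have key : kroneckerPow (kroneckerPow t n) N = fun a b c =>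
      kroneckerPow t (N * n) (fun x => a (finProdFinEquiv.symm x).1 (finProdFinEquiv.symm x).2)
        (fun x => b (finProdFinEquiv.symm x).1 (finProdFinEquiv.symm x).2)
        (fun x => c (finProdFinEquiv.symm x).1 (finProdFinEquiv.symm x).2) := by
    funext a b c
    simp only [kroneckerPow_apply]
    rw [← Fintype.prod_prod_type' (f := fun i j => t (a i j) (b i j) (c i j))]
    exact (Fintype.prod_equiv finProdFinEquiv.symm _ _ fun x => rfl).symm
  rw [key]
  exact tensorRestrictsTo_precomp _ _ _ _

/-- Powers with equal exponents (propositionally) are inter-restrictable. [folklore] -/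
theorem tensorRestrictsTo_kroneckerPow_of_eq [Fintype ι] [Fintype κ] [Fintype μ] [DecidableEq ι]
    [DecidableEq κ] [DecidableEq μ] (t : ι → κ → μ → K) {N N' : ℕ} (h : N = N') :
    TensorRestrictsTo (kroneckerPow t N) (kroneckerPow t N') := by
  subst h
  exact TensorRestrictsTo.refl _

end Generic

section MatMul

variable (K : Type u) [CommSemiring K]

/-- `⟨k,m,n⟩ ⊗ ⟨k',m',n'⟩ ≥ ⟨kk',mm',nn'⟩` (Bläser 2013, p. 24, as a restriction; the tree's
`kroneckerTensor_matMulTensor`). [cite: Blaser2013, §5.2 p. 24] -/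
theorem tensorRestrictsTo_kronecker_matMulTensor (k m n k' m' n' : ℕ) :
    TensorRestrictsTo (kroneckerTensor (matMulTensor K k m n) (matMulTensor K k' m' n'))
      (matMulTensor K (k * k') (m * m') (n * n')) := by
  have key : matMulTensor K (k * k') (m * m') (n * n') = fun a b c =>
      kroneckerTensor (matMulTensor K k m n) (matMulTensor K k' m' n')
        ((doubleIndexEquiv k n k' n').symm a) ((doubleIndexEquiv k m k' m').symm b)
        ((doubleIndexEquiv m n m' n').symm c) := by
    funext a b c
    rw [kroneckerTensor_matMulTensor]
    simp only [Equiv.apply_symm_apply]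
  rw [key]
  exact tensorRestrictsTo_precomp _ _ _ _

/-- Multiples with (propositionally) equal parameters are inter-restrictable. [folklore] -/
theorem tensorRestrictsTo_multiple_matMulTensor_of_eq {F F' k m n k' m' n' : ℕ} (hF : F = F')
    (hk : k = k') (hm : m = m') (hn : n = n') :
    TensorRestrictsTo (kroneckerTensor (unitTensor K F) (matMulTensor K k m n))
      (kroneckerTensor (unitTensor K F') (matMulTensor K k' m' n')) := by
  subst hF hk hm hn
  exact TensorRestrictsTo.refl _

/-- `⟨n⟩` read through a bijection `Fin n ≃ Fin F × Fin q` is `⟨F⟩ ⊗ ⟨q⟩`. [folklore] -/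
theorem unitTensor_eq_kronecker_comp {n F q : ℕ} (e : Fin n ≃ Fin F × Fin q) :
    unitTensor K n = fun a b c =>
      kroneckerTensor (unitTensor K F) (unitTensor K q) (e a) (e b) (e c) := by
  funext a b c
  simp only [unitTensor_apply, kroneckerTensor_apply]
  have hmul : ∀ (P Q : Prop) [Decidable P] [Decidable Q],
      ((if P then (1 : K) else 0) * if Q then 1 else 0) = if P ∧ Q then 1 else 0 := by
    intro P Q _ _
    by_cases hP : P <;> by_cases hQ : Q <;> simp [hP, hQ]
  rw [hmul]
  refine if_congr ⟨fun ⟨hab, hbc⟩ => ?_, fun ⟨⟨h1, h2⟩, ⟨h3, h4⟩⟩ =>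
    ⟨e.injective (Prod.ext h1 h3), e.injective (Prod.ext h2 h4)⟩⟩ rfl rfl
  subst hab; subst hbc
  exact ⟨⟨rfl, rfl⟩, ⟨rfl, rfl⟩⟩

/-- `⟨F⟩ ⊗ ⟨q⟩ ≥ ⟨F q⟩` (indeed `≅`, relabelling by `finProdFinEquiv`). [folklore] -/
theorem tensorRestrictsTo_unitTensor_mul (F q : ℕ) :
    TensorRestrictsTo (kroneckerTensor (unitTensor K F) (unitTensor K q)) (unitTensor K (F * q)) := by
  rw [unitTensor_eq_kronecker_comp (K := K) (finProdFinEquiv (m := F) (n := q)).symm]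
  exact tensorRestrictsTo_precomp _ _ _ _

/-- **Products of multiples of matrix multiplication tensors**:
`(F ⊙ ⟨A,B,C⟩) ⊗ (F' ⊙ ⟨A',B',C'⟩) ≥ (FF') ⊙ ⟨AA',BB',CC'⟩`. [cite: Blaser2013, §5.2 p. 24] -/
theorem tensorRestrictsTo_kronecker_multiple_matMulTensor (F A B C F' A' B' C' : ℕ) :
    TensorRestrictsTo
      (kroneckerTensor (kroneckerTensor (unitTensor K F) (matMulTensor K A B C))
        (kroneckerTensor (unitTensor K F') (matMulTensor K A' B' C')))
      (kroneckerTensor (unitTensor K (F * F')) (matMulTensor K (A * A') (B * B') (C * C'))) :=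
  (tensorRestrictsTo_kronecker_interchange _ _ _ _).trans
    ((tensorRestrictsTo_unitTensor_mul K F F').kronecker
      (tensorRestrictsTo_kronecker_matMulTensor K A B C A' B' C'))

/-- **Rotating a multiple of a matrix multiplication tensor**: `rot(F ⊙ ⟨A,B,C⟩) ≥ F ⊙ ⟨B,C,A⟩`
(relabelling: swap the coordinates of the first and third index sets; the tree's
`matMulTensor_rotate`). [cite: Blaser2013, Lemma 5.5 (proof, p. 22)] -/
theorem tensorRestrictsTo_rotate_multiple_matMulTensor (F A B C : ℕ) :
    TensorRestrictsTo (rotate (kroneckerTensor (unitTensor K F) (matMulTensor K A B C)))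
      (kroneckerTensor (unitTensor K F) (matMulTensor K B C A)) := by
  have key : rotate (kroneckerTensor (unitTensor K F) (matMulTensor K A B C)) = fun b c a =>
      kroneckerTensor (unitTensor K F) (matMulTensor K B C A)
        ((Equiv.prodCongr (Equiv.refl _) (Equiv.prodComm _ _)) b)
        ((Equiv.refl _) c)
        ((Equiv.prodCongr (Equiv.refl _) (Equiv.prodComm _ _)) a) := by
    funext b c a
    simp only [rotate_apply, kroneckerTensor_apply, unitTensor_apply, Equiv.prodCongr_apply,
      Equiv.coe_refl, Prod.map_fst, Prod.map_snd, id_eq, Equiv.refl_apply, Equiv.prodComm_apply]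
    rw [matMulTensor_rotate]
    congr 1
    exact if_congr ⟨fun ⟨h1, h2⟩ => ⟨h2, (h1.trans h2).symm⟩,
      fun ⟨h1, h2⟩ => ⟨(h1.trans h2).symm, h1⟩⟩ rfl rfl
  rw [key]
  exact tensorRestrictsTo_of_reindex _ _ _ _

end MatMul

end Literature.Barriers.MatrixMultiplication

end
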